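import Summits.RiemannHypothesis.RiemannHypothesis.Theorems.SemilocalDeletionDipoleHalfRoomRungs
import Summits.RiemannHypothesis.RiemannHypothesis.Theorems.HandoffLoadCeiling
import Summits.RiemannHypothesis.RiemannHypothesis.Theorems.MotivicDoorRungs
import HarnessLib

/-!
# The deletion cliff UNDER RH: every wall's deficit is pinned to `[cap(q) − 2ε(δ), cap(q)]`, and the falsifiers

`SemilocalDeletionDipoleHalfRoom.lean` proved, under ONE rung of Weil positivity, the half-room law
`cap(q) − 2ε(δ) ≤ D_q((log q)/2 + δ) ≤ cap(q)` (`cap(q) = log q/√q`, `ε = weilGroundEnergy`) for the OLD semi-local form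
`Q_{S_q}` just past its entrance, at a wall of consecutive primes `q < q'`; `SemilocalDeletionDipoleHalfRoomRungs.lean` made it
unconditional at the walls `2 < 3` and `3 < 5`.  By Weil's criterion in Yoshida's form (tree:
`riemannHypothesis_iff_forall_weilPositivityOn`, Bombieri 2000 Thm 2) RH supplies EVERY rung, so:

* §1 **under RH the deficit law holds at every wall and every admissible half-room** (`0 < δ ≤ (log q' − log q)/2`; the
  Bertrand condition `2δ < log q` is automatic: `log_lt_two_mul_log_of_consecutivePrimes`), in all three sectors; in particular the
  handoff track's LOAD `r(q) = D_q((log q')/2)/cap(q)` lies in `[1 − 2ε(δ_q)/cap(q), 1 − ε((log q')/2)/cap(q)]`, `δ_q = (log q' − log q)/2`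
  — the tree had the upper clause (`HandoffLoadCeiling`, and `RH ↔ ∀ q, r(q) ≤ 1`); the LOWER clause is new: under RH a load
  cannot be small after a long gap;
* §2 **falsifiers** (contrapositives; the floor-side ones are in `SemilocalDeletionCliffFalsifiers.lean`): ONE certified wall with
  `D_q((log q)/2 + δ) < cap(q) − 2ε(δ)`, or a load `r(q) < 1 − 2ε(δ_q)/cap(q)`, refutes RH.  The cell's certified loads (conj-1, two-lineage float; cc-s2-1 LOADFLOOR-E floors in
  brackets) `r(2) = 0.878 [≥ 0.631]`, `r(3) = 0.972 [≥ 0.908]`, `r(7) = 0.966 [≥ 0.844]` sit inside RH's band; after short gaps the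
  band is all of `(−∞, 1]` (`2ε(δ_q) ≥ cap(q)`), consistent with the measured dips `r(11) = 0.760`, `r(13) = 0.897`;
* §3 the general single-deletion statement under RH for any finite `S` containing every prime visible on the window;
* (the THRESHOLD OFFSET LAW `a*(S_q) < (log q)/2 + δ` whenever `2ε(δ) < cap(q)` is already in the tree: `SemilocalDeletionDipoleHalfRoom` §5.)

These are consequences of RH (and potential refutations of it), not evidence for it.
-/

set_option linter.dupNamespace false

noncomputable section

open Complex Filter Set MeasureTheory
open scoped Real Topology ComplexConjugate

namespace Summit.RiemannHypothesis.RiemannHypothesis.Theorems.SemilocalDeletionCliffRH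

open Literature.NumberTheory.LFunctions
open Summit.RiemannHypothesis.RiemannHypothesis.Theorems.HandoffSemilocalEnergy
open Summit.RiemannHypothesis.RiemannHypothesis.Theorems.SemilocalDeletionDipole
open Summit.RiemannHypothesis.RiemannHypothesis.Theorems.SemilocalDeletionDipoleHalfRoom
open Summit.RiemannHypothesis.RiemannHypothesis.Theorems.Handoff
open Summit.RiemannHypothesis.RiemannHypothesis.Theorems.HandoffLoadCeiling

variable {q q' : ℕ} {δ : ℝ}

/-- The window `(log q)/2 + δ` of a wall is positive. -/
theorem window_pos (h : ConsecutivePrimes q q') (hδ0 : 0 < δ) : 0 < Real.log q / 2 + δ := by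
  have := log_prime_pos h.1
  positivity

/-! ## §1  Under RH: the deficit law at every wall -/

/-- **RH ⇒ THE DEFICIT LAW AT EVERY WALL.** For consecutive primes `q < q'` and a half-room `0 < δ` with
`(log q)/2 + δ ≤ (log q')/2`: `cap(q) − 2ε(δ) ≤ D_q((log q)/2 + δ) ≤ cap(q)`. -/
theorem aggregateDeficit_mem_Icc_of_riemannHypothesis (hRH : Summit.RiemannHypothesis) (h : ConsecutivePrimes q q')
    (hδ0 : 0 < δ) (hδq' : Real.log q / 2 + δ ≤ Real.log q' / 2) :
    aggregateDeficit q (Real.log q / 2 + δ) ∈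
      Icc (Real.log q / Real.sqrt q - 2 * weilGroundEnergy δ) (Real.log q / Real.sqrt q) :=
  aggregateDeficit_mem_Icc h hδ0 hδq' (by linarith [log_lt_two_mul_log_of_consecutivePrimes h])
    (MotivicDoor.Rungs.rung_of_riemannHypothesis hRH (window_pos h hδ0))

/-- **RH ⇒ the free-odd bottom of every old form just past its entrance**:
`λ_min(S_q; (log q)/2 + δ; odd) ∈ [−cap(q), −cap(q) + 2ε_ev(δ)]`. -/
theorem semilocalGroundEnergy_primesBelow_odd_mem_Icc_of_riemannHypothesis (hRH : Summit.RiemannHypothesis)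
    (h : ConsecutivePrimes q q') (hδ0 : 0 < δ) (hδq' : Real.log q / 2 + δ ≤ Real.log q' / 2) :
    semilocalGroundEnergy (Nat.primesBelow q) (fun g ↦ ∀ t, g (-t) = -g t) (Real.log q / 2 + δ) ∈
      Icc (-(Real.log q / Real.sqrt q)) (-(Real.log q / Real.sqrt q) + 2 * weilEvenGroundEnergy δ) :=
  semilocalGroundEnergy_primesBelow_odd_mem_Icc h hδ0 hδq' (by linarith [log_lt_two_mul_log_of_consecutivePrimes h])
    (MotivicDoor.Rungs.rung_of_riemannHypothesis hRH (window_pos h hδ0))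

/-- **RH ⇒ the free-even bottom**: `λ_min(S_q; (log q)/2 + δ; even) ∈ [−cap(q), −cap(q) + 2ε_od(δ)]`. -/
theorem semilocalGroundEnergy_primesBelow_even_mem_Icc_of_riemannHypothesis (hRH : Summit.RiemannHypothesis)
    (h : ConsecutivePrimes q q') (hδ0 : 0 < δ) (hδq' : Real.log q / 2 + δ ≤ Real.log q' / 2) :
    semilocalGroundEnergy (Nat.primesBelow q) (fun g ↦ ∀ t, g (-t) = g t) (Real.log q / 2 + δ) ∈
      Icc (-(Real.log q / Real.sqrt q)) (-(Real.log q / Real.sqrt q) + 2 * weilOddGroundEnergy δ) :=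
  semilocalGroundEnergy_primesBelow_even_mem_Icc h hδ0 hδq' (by linarith [log_lt_two_mul_log_of_consecutivePrimes h])
    (MotivicDoor.Rungs.rung_of_riemannHypothesis hRH (window_pos h hδ0))

/-- **RH ⇒ THE TWO-SIDED LOAD LAW**: for every pair of consecutive primes `q < q'`,
`1 − 2ε(δ_q)/cap(q) ≤ r(q) ≤ 1 − ε((log q')/2)/cap(q)`, `δ_q = (log q' − log q)/2` — the handoff track's ceiling
(`handoffLoad_le_one_sub_of_handoffH`) together with the NEW floor of `SemilocalDeletionDipoleHalfRoomRungs`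
(`one_sub_le_handoffLoad_of_handoffH`), both fed by RH. -/
theorem handoffLoad_mem_Icc_of_riemannHypothesis (hRH : Summit.RiemannHypothesis) (h : ConsecutivePrimes q q') :
    handoffLoad q q' ∈
      Icc (1 - 2 * weilGroundEnergy ((Real.log q' - Real.log q) / 2) / (Real.log q / Real.sqrt q))
        (1 - weilGroundEnergy (Real.log q' / 2) / (Real.log q / Real.sqrt q)) := by
  have hq' : (1 : ℝ) < q' := by exact_mod_cast h.2.1.one_lt
  have H : HandoffH q q' := (handoffH_iff_weilPositivityOn h).2
    (MotivicDoor.Rungs.rung_of_riemannHypothesis hRH (by have := Real.log_pos hq'; positivity))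
  exact ⟨one_sub_le_handoffLoad_of_handoffH h H, handoffLoad_le_one_sub_of_handoffH h H⟩

/-! ## §2  Falsifiers: one certified wall outside the band refutes RH -/

/-- **FALSIFIER (deficit below the band).** If `D_q((log q)/2 + δ) < cap(q) − 2ε(δ)` at some wall, then RH is false
(under RH the antisymmetric dipole of the `ε(δ)`-minimiser is an admissible test function of the old form). -/
theorem not_riemannHypothesis_of_aggregateDeficit_lt (h : ConsecutivePrimes q q') (hδ0 : 0 < δ)
    (hδq' : Real.log q / 2 + δ ≤ Real.log q' / 2)
    (hlt : aggregateDeficit q (Real.log q / 2 + δ) < Real.log q / Real.sqrt q - 2 * weilGroundEnergy δ) :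
    ¬ Summit.RiemannHypothesis := by
  intro hRH
  have hm := (aggregateDeficit_mem_Icc_of_riemannHypothesis hRH h hδ0 hδq').1
  linarith

/-- **FALSIFIER (load).** A load `r(q) < 1 − 2ε(δ_q)/cap(q)` at ONE wall refutes RH (companion of the tree's
`RH ↔ ∀ q, r(q) ≤ 1`: under RH the loads are squeezed from BOTH sides). -/
theorem not_riemannHypothesis_of_handoffLoad_lt (h : ConsecutivePrimes q q')
    (hlt : handoffLoad q q' < 1 - 2 * weilGroundEnergy ((Real.log q' - Real.log q) / 2) / (Real.log q / Real.sqrt q)) :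
    ¬ Summit.RiemannHypothesis := by
  intro hRH
  have hm := (handoffLoad_mem_Icc_of_riemannHypothesis hRH h).1
  linarith

/-- **FALSIFIER (sector form).** A free-odd bottom of an old form below its floor, `λ_min(S_q; (log q)/2 + δ; odd) < −cap(q)`, or
above its ceiling, `> −cap(q) + 2ε_ev(δ)`, refutes RH. -/
theorem not_riemannHypothesis_of_odd_not_mem_Icc (h : ConsecutivePrimes q q') (hδ0 : 0 < δ)
    (hδq' : Real.log q / 2 + δ ≤ Real.log q' / 2)
    (hout : semilocalGroundEnergy (Nat.primesBelow q) (fun g ↦ ∀ t, g (-t) = -g t) (Real.log q / 2 + δ) ∉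
      Icc (-(Real.log q / Real.sqrt q)) (-(Real.log q / Real.sqrt q) + 2 * weilEvenGroundEnergy δ)) :
    ¬ Summit.RiemannHypothesis :=
  fun hRH ↦ hout (semilocalGroundEnergy_primesBelow_odd_mem_Icc_of_riemannHypothesis hRH h hδ0 hδq')

/-! ## §3  Under RH: the single-deletion sandwich for every finite `S` containing the visible primes -/

variable {S : Finset ℕ} {N p : ℕ}

/-- **RH ⇒ the half-room law for every finite `S ⊇ {primes visible on the window}`.** If `S` contains the prime factors of
every prime power `n ≤ N`, `p ∈ S` is prime, `0 < δ`, `2δ < log p` and `(log p)/2 + δ ≤ (log (N+1))/2`, then under RH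
`λ_min(S∖{p}; (log p)/2 + δ) ∈ [−log p/√p, −log p/√p + 2λ_min(S; δ)]`. -/
theorem semilocalGroundEnergy_erase_top_mem_Icc_of_riemannHypothesis (hRH : Summit.RiemannHypothesis)
    (hS : ∀ n ≤ N, IsPrimePow n → n.primeFactors ⊆ S) (hp : p.Prime) (hpS : p ∈ S) (hδ0 : 0 < δ)
    (hδ : 2 * δ < Real.log p) (hN : Real.log p / 2 + δ ≤ Real.log ((N : ℝ) + 1) / 2) :
    semilocalGroundEnergy (S.erase p) (fun _ ↦ True) (Real.log p / 2 + δ) ∈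
      Icc (-(Real.log p / Real.sqrt p)) (-(Real.log p / Real.sqrt p) + 2 * semilocalGroundEnergy S (fun _ ↦ True) δ) := by
  have hc0 : 0 < Real.log p / 2 + δ := by have := log_prime_pos hp; positivity
  have hW : WeilPositivityOn (Real.log ((N : ℝ) + 1) / 2) :=
    MotivicDoor.Rungs.rung_of_riemannHypothesis hRH (lt_of_lt_of_le hc0 hN)
  have hposS : WeilSemilocalPositivityOn S (Real.log p / 2 + δ) :=
    ((weilSemilocalPositivityOn_iff_weilPositivityOn_of_forall hS).2 hW).mono hN
  exact semilocalGroundEnergy_erase_top_mem_Icc hp hpS hδ0 hδ hposS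

end Summit.RiemannHypothesis.RiemannHypothesis.Theorems.SemilocalDeletionCliffRH

end
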